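import Summits.PneNP.PneNP.Theorems.KarlinRubinMonotoneSufficesTransportMixture

/-!
# Crux `MonotoneSuffices` (stmt-PneNP-18026), line `slice-transport` — stub `stub_transport`, part 8:
# the averaged slice error sum is small, hence some ranking and deletion count is good

Generic setting of parts 6–7 (test `f` on `α → Bool`, nonempty family of protected `κ`-sets `Kf A`,
`A ∈ 𝒜`, transport slice `m = ⌊N/2⌋ + Δ`, weights `λ(d) = b N (m - d)`):

* `sum_b_mul_rej_le` — the planted mixture is the unconditional rejection probability up to the
  `ℓ₁`-distance of the two slice profiles: `∑_d λ(d) rej_{m-d} ≤ REJ/(#𝒜 2^{N-κ}) + κ/√(N-κ+1)`;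
* `mixture_bound` — `∑_d λ(d) ∑_σ (sliceErrI + sliceErrII)(f ∘ del σ d) ≤ #rankings · B` with
  `B = #{f = 1}/2^N + REJ/(#𝒜 2^{N-κ}) + κ/√(N-κ+1) + 2Δκ/m + N/(2Δ²)`;
* `exists_good_ranking` — (Adleman) since `∑_d λ(d) ≥ 1/2`, SOME `(σ, d)`, `d ≤ m`, has
  `sliceErrI + sliceErrII ≤ 2B`.
-/

set_option linter.dupNamespace false -- `Summit.PneNP.PneNP.…`: summit = sub-problem name (D-0017 single-conjunct layout)

namespace Summit.PneNP.PneNP.Theorems.MonotoneSuffices.SliceTransport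

open Finset Literature.Computability.Complexity.BinomialTV

variable {α : Type*} [Fintype α] [DecidableEq α] {θ : Type*}

/-- The planted pairs at level `j ≥ κ` number `#𝒜 · C(N-κ, j-κ)`. [folklore] -/
theorem card_pairs_eq (𝒜 : Finset θ) (Kf : θ → Finset α) {κ j : ℕ} (hκ : ∀ A ∈ 𝒜, #(Kf A) = κ)
    (hj : κ ≤ j) :
    (#((𝒜 ×ˢ (univ : Finset (α → Bool))).filter fun p =>
        Kf p.1 ⊆ (univ.filter fun a => p.2 a = true) ∧ #(univ.filter fun a => p.2 a = true) = j) : ℝ) =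
      (#𝒜 : ℝ) * ((Fintype.card α - κ).choose (j - κ) : ℝ) := by
  classical
  rw [card_filter_product_eq_sum]
  have : ∀ A ∈ 𝒜, (#((univ : Finset (α → Bool)).filter fun x =>
      Kf A ⊆ (univ.filter fun a => x a = true) ∧ #(univ.filter fun a => x a = true) = j) : ℝ) =
      ((Fintype.card α - κ).choose (j - κ) : ℝ) := by
    intro A hA
    have h := card_slice_supset (Kf A) (j := j) (by rw [hκ A hA]; exact hj)
    rw [hκ A hA] at h
    rw [← h]
    congr 2
    ext x
    simp only [mem_filter, mem_univ, true_and, and_comm]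
  rw [sum_congr rfl this, sum_const, nsmul_eq_mul]

/-- **Planted mixture**: with `rej_j = #{(A,y) : Kf A ⊆ supp y, |y| = j, ¬ f y}/(#𝒜 · C(N-κ, j-κ))`,
`∑_{d ≤ m} b N (m-d) · rej_{m-d} ≤ REJ/(#𝒜 · 2^{N-κ}) + κ/√(N-κ+1)` where
`REJ = #{(A,y) : Kf A ⊆ supp y, ¬ f y}` (`κ ≤ m ≤ N`, `𝒜` nonempty). [folklore] -/
theorem sum_b_mul_rej_le (f : (α → Bool) → Bool) (𝒜 : Finset θ) (h𝒜 : 𝒜.Nonempty) (Kf : θ → Finset α)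
    {κ m : ℕ} (hκ : ∀ A ∈ 𝒜, #(Kf A) = κ) (hκm : κ ≤ m) (hm : m ≤ Fintype.card α) :
    ∑ d ∈ range (m + 1), b (Fintype.card α) (m - d) *
        ((#((𝒜 ×ˢ (univ : Finset (α → Bool))).filter fun p =>
            Kf p.1 ⊆ (univ.filter fun a => p.2 a = true) ∧ #(univ.filter fun a => p.2 a = true) = m - d ∧
            f p.2 = false) : ℝ) / ((#𝒜 : ℝ) * ((Fintype.card α - κ).choose (m - d - κ) : ℝ))) ≤
      (#((𝒜 ×ˢ (univ : Finset (α → Bool))).filter fun p =>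
          Kf p.1 ⊆ (univ.filter fun a => p.2 a = true) ∧ f p.2 = false) : ℝ) /
        ((#𝒜 : ℝ) * 2 ^ (Fintype.card α - κ)) +
      (κ : ℝ) / Real.sqrt ((Fintype.card α - κ : ℕ) + 1) := by
  classical
  set N := Fintype.card α with hN
  -- the level-`j` rejection count and its ratio
  set REJ : ℕ → ℝ := fun j => (#((𝒜 ×ˢ (univ : Finset (α → Bool))).filter fun p =>
    Kf p.1 ⊆ (univ.filter fun a => p.2 a = true) ∧ #(univ.filter fun a => p.2 a = true) = j ∧ f p.2 = false) : ℝ)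
    with hREJ
  set r : ℕ → ℝ := fun j => REJ j / ((#𝒜 : ℝ) * ((N - κ).choose (j - κ) : ℝ)) with hr
  have h𝒜pos : (0 : ℝ) < #𝒜 := by exact_mod_cast h𝒜.card_pos
  have hREJ0 : ∀ j, 0 ≤ REJ j := fun j => Nat.cast_nonneg _
  have hREJle : ∀ j, κ ≤ j → REJ j ≤ (#𝒜 : ℝ) * ((N - κ).choose (j - κ) : ℝ) := by
    intro j hj
    rw [hREJ, ← card_pairs_eq 𝒜 Kf hκ hj]
    simp only
    have hsub : ((𝒜 ×ˢ (univ : Finset (α → Bool))).filter fun p =>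
        Kf p.1 ⊆ (univ.filter fun a => p.2 a = true) ∧ #(univ.filter fun a => p.2 a = true) = j ∧ f p.2 = false) ⊆
        ((𝒜 ×ˢ (univ : Finset (α → Bool))).filter fun p =>
          Kf p.1 ⊆ (univ.filter fun a => p.2 a = true) ∧ #(univ.filter fun a => p.2 a = true) = j) := by
      intro p hp
      have h := mem_filter.1 hp
      exact mem_filter.2 ⟨h.1, h.2.1, h.2.2.1⟩
    exact_mod_cast card_le_card hsub
  have hREJlt : ∀ j, j < κ → REJ j = 0 := by
    intro j hj
    rw [hREJ]
    simp only [Nat.cast_eq_zero, card_eq_zero, filter_eq_empty_iff]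
    rintro ⟨A, y⟩ hp ⟨hKy, hyj, -⟩
    have := card_le_card hKy
    rw [hκ A (mem_product.1 hp).1] at this
    simp only at hyj this
    omega
  have hr0 : ∀ j, 0 ≤ r j := fun j => div_nonneg (hREJ0 j) (by positivity)
  have hr1 : ∀ j, r j ≤ 1 := by
    intro j
    rw [hr]
    rcases lt_or_ge j κ with hj | hj
    · simp only [hREJlt j hj, zero_div]; exact zero_le_one
    · exact div_le_one_of_le₀ (hREJle j hj) (by positivity)
  -- reflect `d ↦ m - d`, drop the vanishing terms `j < κ`, reindex `j = κ + t`
  change ∑ d ∈ range (m + 1), b N (m - d) * r (m - d) ≤ _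
  have href := sum_range_reflect (fun j => b N j * r j) (m + 1)
  simp only [Nat.add_sub_cancel] at href
  rw [href, ← sum_range_add_sum_Ico _ (show κ ≤ m + 1 by omega)]
  have hzero : ∑ j ∈ range κ, b N j * r j = 0 := by
    refine sum_eq_zero fun j hj => ?_
    rw [hr]
    simp [hREJlt j (mem_range.1 hj)]
  rw [hzero, zero_add, sum_Ico_eq_sum_range]
  -- termwise: `b N (κ+t) r ≤ b (N-κ) t r + |b N (κ+t) - b (N-κ) t|`
  have hterm : ∀ t ∈ range (m + 1 - κ), b N (κ + t) * r (κ + t) ≤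
      REJ (κ + t) / ((#𝒜 : ℝ) * 2 ^ (N - κ)) + |b N (t + κ) - b (N - κ) t| := by
    intro t _
    have h1 : b N (κ + t) * r (κ + t) ≤ b (N - κ) t * r (κ + t) + |b N (t + κ) - b (N - κ) t| := by
      have := hr0 (κ + t)
      have := hr1 (κ + t)
      rw [add_comm t κ]
      have hab : b N (κ + t) - b (N - κ) t ≤ |b N (κ + t) - b (N - κ) t| := le_abs_self _
      nlinarith [abs_nonneg (b N (κ + t) - b (N - κ) t)]
    have h2 : b (N - κ) t * r (κ + t) ≤ REJ (κ + t) / ((#𝒜 : ℝ) * 2 ^ (N - κ)) := by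
      rw [hr]
      simp only [Nat.add_sub_cancel_left]
      rcases lt_or_ge (N - κ) t with ht | ht
      · rw [b_eq_zero_of_lt ht, zero_mul]
        exact div_nonneg (hREJ0 _) (by positivity)
      · have hc : (0 : ℝ) < ((N - κ).choose t : ℝ) := by exact_mod_cast Nat.choose_pos ht
        unfold b
        rw [div_mul_div_comm, div_le_div_iff₀ (by positivity) (by positivity)]
        have := hREJ0 (κ + t)
        nlinarith [hc, h𝒜pos, pow_pos (show (0:ℝ) < 2 by norm_num) (N - κ)]
    linarith
  refine (sum_le_sum hterm).trans ?_
  rw [sum_add_distrib, ← sum_div]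
  refine add_le_add ?_ ?_
  · exact div_le_div_of_nonneg_right (sum_card_pairs_reject_le f 𝒜 Kf κ (m + 1 - κ)) (by positivity)
  · exact sum_abs_b_shift_le (N := N) (K := κ) (by omega) (m + 1 - κ)

/-- A ratio of nested filter cardinalities is at most one. [folklore] -/
theorem card_div_card_le_one {β : Type*} {s t : Finset β} (h : s ⊆ t) : (#s : ℝ) / (#t : ℝ) ≤ 1 :=
  div_le_one_of_le₀ (by exact_mod_cast card_le_card h) (Nat.cast_nonneg _)

/-- **The mixture bound.** With `λ(d) = b N (m - d)` on `d ≤ m = ⌊N/2⌋ + Δ` (`0 < Δ`, `2Δ ≤ m`,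
`κ ≤ m ≤ N`), the `λ`-mixture of the ranking-summed slice error sums of `f ∘ del σ d` is at most
`#rankings · (#{f=1}/2^N + REJ/(#𝒜 2^{N-κ}) + κ/√(N-κ+1) + 2Δκ/m + N/(2Δ²))`. [folklore] -/
theorem mixture_bound (f : (α → Bool) → Bool) (𝒜 : Finset θ) (h𝒜 : 𝒜.Nonempty) (Kf : θ → Finset α)
    {κ m Δ : ℕ} (hκ : ∀ A ∈ 𝒜, #(Kf A) = κ) (hκm : κ ≤ m) (hm : m ≤ Fintype.card α) (hm1 : 1 ≤ m)
    (hmΔ : m = Fintype.card α / 2 + Δ) (hΔ : 0 < Δ) (h2Δ : 2 * Δ ≤ m) :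
    ∑ d ∈ range (m + 1), b (Fintype.card α) (m - d) *
      ∑ σ : α ≃ Fin (Fintype.card α),
        ((#((univ : Finset (α → Bool)).filter fun x => #(univ.filter fun a => x a = true) = m ∧
            f (fun a => x a && decide (d ≤ #(univ.filter fun b => x b = true ∧ σ b < σ a))) = true) : ℝ) /
          #((univ : Finset (α → Bool)).filter fun x => #(univ.filter fun a => x a = true) = m) +
        (#((𝒜 ×ˢ (univ : Finset (α → Bool))).filter fun p =>
            Kf p.1 ⊆ (univ.filter fun a => p.2 a = true) ∧ #(univ.filter fun a => p.2 a = true) = m ∧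
            f (fun a => p.2 a && decide (d ≤ #(univ.filter fun b => p.2 b = true ∧ σ b < σ a))) = false) : ℝ) /
          #((𝒜 ×ˢ (univ : Finset (α → Bool))).filter fun p =>
            Kf p.1 ⊆ (univ.filter fun a => p.2 a = true) ∧ #(univ.filter fun a => p.2 a = true) = m)) ≤
    (Fintype.card (α ≃ Fin (Fintype.card α)) : ℝ) *
      ((#((univ : Finset (α → Bool)).filter fun y => f y = true) : ℝ) / 2 ^ Fintype.card α +
        ((#((𝒜 ×ˢ (univ : Finset (α → Bool))).filter fun p =>
            Kf p.1 ⊆ (univ.filter fun a => p.2 a = true) ∧ f p.2 = false) : ℝ) /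
          ((#𝒜 : ℝ) * 2 ^ (Fintype.card α - κ)) +
          (κ : ℝ) / Real.sqrt ((Fintype.card α - κ : ℕ) + 1)) +
        2 * (Δ : ℝ) * κ / m + (Fintype.card α : ℝ) / 2 / (Δ : ℝ) ^ 2) := by
  classical
  set N := Fintype.card α with hN
  set EE : ℝ := (Fintype.card (α ≃ Fin N) : ℝ) with hEE
  -- names for the per-`(σ, d)` errors and the per-`d` sums
  set EI : (α ≃ Fin N) → ℕ → ℝ := fun σ d =>
    (#((univ : Finset (α → Bool)).filter fun x => #(univ.filter fun a => x a = true) = m ∧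
        f (fun a => x a && decide (d ≤ #(univ.filter fun b => x b = true ∧ σ b < σ a))) = true) : ℝ) /
      #((univ : Finset (α → Bool)).filter fun x => #(univ.filter fun a => x a = true) = m) with hEI
  set EII : (α ≃ Fin N) → ℕ → ℝ := fun σ d =>
    (#((𝒜 ×ˢ (univ : Finset (α → Bool))).filter fun p =>
        Kf p.1 ⊆ (univ.filter fun a => p.2 a = true) ∧ #(univ.filter fun a => p.2 a = true) = m ∧
        f (fun a => p.2 a && decide (d ≤ #(univ.filter fun b => p.2 b = true ∧ σ b < σ a))) = false) : ℝ) /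
      #((𝒜 ×ˢ (univ : Finset (α → Bool))).filter fun p =>
        Kf p.1 ⊆ (univ.filter fun a => p.2 a = true) ∧ #(univ.filter fun a => p.2 a = true) = m) with hEII
  set acc : ℕ → ℝ := fun j => (#((univ : Finset (α → Bool)).filter fun y =>
    #(univ.filter fun a => y a = true) = j ∧ f y = true) : ℝ) with hacc
  set REJ : ℕ → ℝ := fun j => (#((𝒜 ×ˢ (univ : Finset (α → Bool))).filter fun p =>
    Kf p.1 ⊆ (univ.filter fun a => p.2 a = true) ∧ #(univ.filter fun a => p.2 a = true) = j ∧ f p.2 = false) : ℝ)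
    with hREJ
  set rt : ℕ → ℝ := fun j => REJ j / ((#𝒜 : ℝ) * ((N - κ).choose (j - κ) : ℝ)) with hrt
  change ∑ d ∈ range (m + 1), b N (m - d) * ∑ σ : α ≃ Fin N, (EI σ d + EII σ d) ≤ _
  -- per-`d` facts
  have hI : ∀ d, d ≤ m → ∑ σ : α ≃ Fin N, EI σ d = EE * acc (m - d) / (N.choose (m - d) : ℝ) := by
    intro d hd
    have h := sum_sliceErrI_del f hd hm (α := α)
    rw [← hN] at h
    rw [hEI, hacc, hEE]
    simp only
    rw [h, mul_div_assoc]
  have hII : ∀ d, d ≤ m → ∑ σ : α ≃ Fin N, EII σ d ≤ EE * ((κ : ℝ) * d / m + rt (m - d)) := by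
    intro d hd
    have h := sum_sliceErrII_del_le f 𝒜 h𝒜 Kf hκ hκm hd hm hm1 (α := α)
    rw [← hN] at h
    exact h
  have hEI1 : ∀ σ d, EI σ d ≤ 1 := fun σ d => card_div_card_le_one (fun x hx => by
    rw [mem_filter] at hx ⊢; exact ⟨hx.1, hx.2.1⟩)
  have hEII1 : ∀ σ d, EII σ d ≤ 1 := fun σ d => card_div_card_le_one (fun p hp => by
    rw [mem_filter] at hp ⊢; exact ⟨hp.1, hp.2.1, hp.2.2.1⟩)
  have hEI0 : ∀ σ d, 0 ≤ EI σ d := fun σ d => div_nonneg (Nat.cast_nonneg _) (Nat.cast_nonneg _)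
  have hEII0 : ∀ σ d, 0 ≤ EII σ d := fun σ d => div_nonneg (Nat.cast_nonneg _) (Nat.cast_nonneg _)
  have htriv : ∀ d, ∑ σ : α ≃ Fin N, (EI σ d + EII σ d) ≤ 2 * EE := by
    intro d
    calc ∑ σ : α ≃ Fin N, (EI σ d + EII σ d) ≤ ∑ _σ : α ≃ Fin N, (2 : ℝ) :=
          sum_le_sum fun σ _ => by linarith [hEI1 σ d, hEII1 σ d]
      _ = 2 * EE := by rw [sum_const, nsmul_eq_mul, card_univ, hEE]; ring
  have hsum0 : ∀ d, 0 ≤ ∑ σ : α ≃ Fin N, (EI σ d + EII σ d) :=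
    fun d => sum_nonneg fun σ _ => add_nonneg (hEI0 σ d) (hEII0 σ d)
  have hw0 : ∀ d, 0 ≤ b N (m - d) := fun d => b_nonneg _ _
  have hacc0 : ∀ j, 0 ≤ acc j := fun j => Nat.cast_nonneg _
  have hrt0 : ∀ j, 0 ≤ rt j := fun j => div_nonneg (Nat.cast_nonneg _) (by positivity)
  have hEE0 : 0 ≤ EE := Nat.cast_nonneg _
  have hmpos : (0 : ℝ) < m := by exact_mod_cast hm1
  -- split `d ≤ 2Δ` / `d > 2Δ`
  rw [← sum_range_add_sum_Ico _ (show 2 * Δ + 1 ≤ m + 1 by omega)]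
  -- the far part
  have hfar : ∑ d ∈ Ico (2 * Δ + 1) (m + 1), b N (m - d) * ∑ σ : α ≃ Fin N, (EI σ d + EII σ d) ≤
      EE * ((N : ℝ) / 2 / (Δ : ℝ) ^ 2) := by
    calc ∑ d ∈ Ico (2 * Δ + 1) (m + 1), b N (m - d) * ∑ σ : α ≃ Fin N, (EI σ d + EII σ d)
        ≤ ∑ d ∈ Ico (2 * Δ + 1) (m + 1), b N (m - d) * (2 * EE) :=
          sum_le_sum fun d _ => mul_le_mul_of_nonneg_left (htriv d) (hw0 d)
      _ = (∑ d ∈ Ico (2 * Δ + 1) (m + 1), b N (m - d)) * (2 * EE) := by rw [sum_mul]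
      _ ≤ ((N : ℝ) / 4 / (Δ : ℝ) ^ 2) * (2 * EE) :=
          mul_le_mul_of_nonneg_right (sum_b_Ico_le N hmΔ hΔ h2Δ) (by positivity)
      _ = EE * ((N : ℝ) / 2 / (Δ : ℝ) ^ 2) := by ring
  -- the near part
  have hnear : ∑ d ∈ range (2 * Δ + 1), b N (m - d) * ∑ σ : α ≃ Fin N, (EI σ d + EII σ d) ≤
      EE * ((#((univ : Finset (α → Bool)).filter fun y => f y = true) : ℝ) / 2 ^ N +
        ((#((𝒜 ×ˢ (univ : Finset (α → Bool))).filter fun p =>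
            Kf p.1 ⊆ (univ.filter fun a => p.2 a = true) ∧ f p.2 = false) : ℝ) / ((#𝒜 : ℝ) * 2 ^ (N - κ)) +
          (κ : ℝ) / Real.sqrt ((N - κ : ℕ) + 1)) + 2 * (Δ : ℝ) * κ / m) := by
    -- termwise bound on `d ≤ 2Δ`
    have hd1 : ∀ d ∈ range (2 * Δ + 1), b N (m - d) * ∑ σ : α ≃ Fin N, (EI σ d + EII σ d) ≤
        EE * (b N (m - d) * (acc (m - d) / (N.choose (m - d) : ℝ))) +
          EE * (2 * (Δ : ℝ) * κ / m) * b N (m - d) + EE * (b N (m - d) * rt (m - d)) := by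
      intro d hd
      rw [mem_range] at hd
      have hdm : d ≤ m := by omega
      have hsplit : ∑ σ : α ≃ Fin N, (EI σ d + EII σ d) ≤
          EE * acc (m - d) / (N.choose (m - d) : ℝ) + EE * ((κ : ℝ) * d / m + rt (m - d)) := by
        rw [sum_add_distrib, hI d hdm]
        exact add_le_add le_rfl (hII d hdm)
      have hκd : (κ : ℝ) * d / m ≤ 2 * (Δ : ℝ) * κ / m := by
        rw [div_le_div_iff_of_pos_right hmpos]
        have : (d : ℝ) ≤ 2 * Δ := by exact_mod_cast (by omega : d ≤ 2 * Δ)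
        nlinarith [Nat.cast_nonneg (α := ℝ) κ]
      calc b N (m - d) * ∑ σ : α ≃ Fin N, (EI σ d + EII σ d)
          ≤ b N (m - d) * (EE * acc (m - d) / (N.choose (m - d) : ℝ) + EE * (2 * (Δ : ℝ) * κ / m + rt (m - d))) := by
            refine mul_le_mul_of_nonneg_left (hsplit.trans (add_le_add le_rfl ?_)) (hw0 d)
            exact mul_le_mul_of_nonneg_left (add_le_add hκd le_rfl) hEE0
        _ = _ := by ring
    refine (sum_le_sum hd1).trans ?_
    rw [sum_add_distrib, sum_add_distrib, ← mul_sum, ← mul_sum, ← mul_sum]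
    -- extend the two nonnegative sums to `d ≤ m` and use parts 7 and 8
    have hsub : range (2 * Δ + 1) ⊆ range (m + 1) := range_subset_range.2 (by omega)
    have hA : ∑ d ∈ range (2 * Δ + 1), b N (m - d) * (acc (m - d) / (N.choose (m - d) : ℝ)) ≤
        (#((univ : Finset (α → Bool)).filter fun y => f y = true) : ℝ) / 2 ^ N :=
      (sum_le_sum_of_subset_of_nonneg hsub fun d _ _ => mul_nonneg (hw0 d) (div_nonneg (hacc0 _) (Nat.cast_nonneg _))).trans
        (sum_b_mul_acc_div_le f hm)
    have hB : ∑ d ∈ range (2 * Δ + 1), b N (m - d) ≤ 1 := sum_b_reflect_range_le_one N m Δ h2Δ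
    have hC : ∑ d ∈ range (2 * Δ + 1), b N (m - d) * rt (m - d) ≤
        (#((𝒜 ×ˢ (univ : Finset (α → Bool))).filter fun p =>
            Kf p.1 ⊆ (univ.filter fun a => p.2 a = true) ∧ f p.2 = false) : ℝ) / ((#𝒜 : ℝ) * 2 ^ (N - κ)) +
          (κ : ℝ) / Real.sqrt ((N - κ : ℕ) + 1) :=
      (sum_le_sum_of_subset_of_nonneg hsub fun d _ _ => mul_nonneg (hw0 d) (hrt0 _)).trans
        (sum_b_mul_rej_le f 𝒜 h𝒜 Kf hκ hκm hm)
    have h2Δκ : 0 ≤ EE * (2 * (Δ : ℝ) * κ / m) := by positivity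
    calc EE * ∑ d ∈ range (2 * Δ + 1), b N (m - d) * (acc (m - d) / (N.choose (m - d) : ℝ)) +
          EE * (2 * (Δ : ℝ) * κ / m) * ∑ d ∈ range (2 * Δ + 1), b N (m - d) +
          EE * ∑ d ∈ range (2 * Δ + 1), b N (m - d) * rt (m - d)
        ≤ EE * ((#((univ : Finset (α → Bool)).filter fun y => f y = true) : ℝ) / 2 ^ N) +
          EE * (2 * (Δ : ℝ) * κ / m) * 1 +
          EE * ((#((𝒜 ×ˢ (univ : Finset (α → Bool))).filter fun p =>
            Kf p.1 ⊆ (univ.filter fun a => p.2 a = true) ∧ f p.2 = false) : ℝ) / ((#𝒜 : ℝ) * 2 ^ (N - κ)) +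
            (κ : ℝ) / Real.sqrt ((N - κ : ℕ) + 1)) :=
          add_le_add (add_le_add (mul_le_mul_of_nonneg_left hA hEE0) (mul_le_mul_of_nonneg_left hB h2Δκ))
            (mul_le_mul_of_nonneg_left hC hEE0)
      _ = _ := by ring
  linarith [hfar, hnear]

/-- **Some ranking and deletion count is good (Adleman).** Under the hypotheses of `mixture_bound`
and `2N ≤ (Δ+1)²` (so the weights have mass `≥ 1/2`), there are `σ` and `d ≤ m` whose slice error sum
`sliceErrI + sliceErrII` of `f ∘ del σ d` at `m` is at most twice the bracket of `mixture_bound`.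
[folklore] -/
theorem exists_good_ranking (f : (α → Bool) → Bool) (𝒜 : Finset θ) (h𝒜 : 𝒜.Nonempty) (Kf : θ → Finset α)
    {κ m Δ : ℕ} (hκ : ∀ A ∈ 𝒜, #(Kf A) = κ) (hκm : κ ≤ m) (hm : m ≤ Fintype.card α) (hm1 : 1 ≤ m)
    (hmΔ : m = Fintype.card α / 2 + Δ) (hΔ : 0 < Δ) (h2Δ : 2 * Δ ≤ m)
    (hΔN : 2 * Fintype.card α ≤ (Δ + 1) ^ 2) :
    ∃ (σ : α ≃ Fin (Fintype.card α)) (d : ℕ), d ≤ m ∧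
      (#((univ : Finset (α → Bool)).filter fun x => #(univ.filter fun a => x a = true) = m ∧
          f (fun a => x a && decide (d ≤ #(univ.filter fun b => x b = true ∧ σ b < σ a))) = true) : ℝ) /
        #((univ : Finset (α → Bool)).filter fun x => #(univ.filter fun a => x a = true) = m) +
      (#((𝒜 ×ˢ (univ : Finset (α → Bool))).filter fun p =>
          Kf p.1 ⊆ (univ.filter fun a => p.2 a = true) ∧ #(univ.filter fun a => p.2 a = true) = m ∧
          f (fun a => p.2 a && decide (d ≤ #(univ.filter fun b => p.2 b = true ∧ σ b < σ a))) = false) : ℝ) /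
        #((𝒜 ×ˢ (univ : Finset (α → Bool))).filter fun p =>
          Kf p.1 ⊆ (univ.filter fun a => p.2 a = true) ∧ #(univ.filter fun a => p.2 a = true) = m) ≤
      2 * ((#((univ : Finset (α → Bool)).filter fun y => f y = true) : ℝ) / 2 ^ Fintype.card α +
        ((#((𝒜 ×ˢ (univ : Finset (α → Bool))).filter fun p =>
            Kf p.1 ⊆ (univ.filter fun a => p.2 a = true) ∧ f p.2 = false) : ℝ) /
          ((#𝒜 : ℝ) * 2 ^ (Fintype.card α - κ)) +
          (κ : ℝ) / Real.sqrt ((Fintype.card α - κ : ℕ) + 1)) +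
        2 * (Δ : ℝ) * κ / m + (Fintype.card α : ℝ) / 2 / (Δ : ℝ) ^ 2) := by
  classical
  set N := Fintype.card α with hN
  set EE : ℝ := (Fintype.card (α ≃ Fin N) : ℝ) with hEE
  set E : (α ≃ Fin N) → ℕ → ℝ := fun σ d =>
    (#((univ : Finset (α → Bool)).filter fun x => #(univ.filter fun a => x a = true) = m ∧
        f (fun a => x a && decide (d ≤ #(univ.filter fun b => x b = true ∧ σ b < σ a))) = true) : ℝ) /
      #((univ : Finset (α → Bool)).filter fun x => #(univ.filter fun a => x a = true) = m) +
    (#((𝒜 ×ˢ (univ : Finset (α → Bool))).filter fun p =>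
        Kf p.1 ⊆ (univ.filter fun a => p.2 a = true) ∧ #(univ.filter fun a => p.2 a = true) = m ∧
        f (fun a => p.2 a && decide (d ≤ #(univ.filter fun b => p.2 b = true ∧ σ b < σ a))) = false) : ℝ) /
      #((𝒜 ×ˢ (univ : Finset (α → Bool))).filter fun p =>
        Kf p.1 ⊆ (univ.filter fun a => p.2 a = true) ∧ #(univ.filter fun a => p.2 a = true) = m) with hE
  set B : ℝ := (#((univ : Finset (α → Bool)).filter fun y => f y = true) : ℝ) / 2 ^ N +
        ((#((𝒜 ×ˢ (univ : Finset (α → Bool))).filter fun p =>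
            Kf p.1 ⊆ (univ.filter fun a => p.2 a = true) ∧ f p.2 = false) : ℝ) / ((#𝒜 : ℝ) * 2 ^ (N - κ)) +
          (κ : ℝ) / Real.sqrt ((N - κ : ℕ) + 1)) +
        2 * (Δ : ℝ) * κ / m + (N : ℝ) / 2 / (Δ : ℝ) ^ 2 with hB
  change ∃ (σ : α ≃ Fin N) (d : ℕ), d ≤ m ∧ E σ d ≤ 2 * B
  have hmix : ∑ d ∈ range (m + 1), b N (m - d) * ∑ σ : α ≃ Fin N, E σ d ≤ EE * B :=
    mixture_bound f 𝒜 h𝒜 Kf hκ hκm hm hm1 hmΔ hΔ h2Δ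
  have hW : (1 : ℝ) / 2 ≤ ∑ d ∈ range (m + 1), b N (m - d) := half_le_sum_b_reflect N hmΔ hΔN
  have hB0 : 0 ≤ B := by rw [hB]; positivity
  -- positive weights
  set Dp := (range (m + 1)).filter fun d => 0 < b N (m - d) with hDp
  have hWp : ∑ d ∈ Dp, b N (m - d) = ∑ d ∈ range (m + 1), b N (m - d) := by
    rw [hDp, sum_filter]
    refine sum_congr rfl fun d _ => ?_
    split_ifs with h
    · rfl
    · exact le_antisymm (b_nonneg _ _) (not_lt.1 h) |>.symm ▸ rfl
  have hDpne : Dp.Nonempty := by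
    by_contra hne
    rw [not_nonempty_iff_eq_empty] at hne
    have : ∑ d ∈ Dp, b N (m - d) = 0 := by rw [hne, sum_empty]
    linarith
  haveI : Nonempty (α ≃ Fin N) := ⟨Fintype.equivFin α⟩
  set I := Dp ×ˢ (univ : Finset (α ≃ Fin N)) with hI
  have hIne : I.Nonempty := hDpne.product univ_nonempty
  have hle : ∑ q ∈ I, b N (m - q.1) * E q.2 q.1 ≤ ∑ q ∈ I, b N (m - q.1) * (2 * B) := by
    have h1 : ∑ q ∈ I, b N (m - q.1) * E q.2 q.1 = ∑ d ∈ range (m + 1), b N (m - d) * ∑ σ : α ≃ Fin N, E σ d := by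
      rw [hI, sum_product]
      simp only [← mul_sum]
      rw [hDp, sum_filter]
      refine sum_congr rfl fun d _ => ?_
      split_ifs with h
      · rfl
      · have : b N (m - d) = 0 := le_antisymm (not_lt.1 h) (b_nonneg _ _)
        rw [this, zero_mul]
    have h2 : ∑ q ∈ I, b N (m - q.1) * (2 * B) = (∑ d ∈ range (m + 1), b N (m - d)) * (EE * (2 * B)) := by
      rw [hI, sum_product, ← hWp, sum_mul]
      refine sum_congr rfl fun d _ => ?_
      simp only [sum_const, card_univ, nsmul_eq_mul, hEE]
      ring
    rw [h1, h2]
    calc ∑ d ∈ range (m + 1), b N (m - d) * ∑ σ : α ≃ Fin N, E σ d ≤ EE * B := hmix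
      _ ≤ (∑ d ∈ range (m + 1), b N (m - d)) * (EE * (2 * B)) := by
          have hEE0 : 0 ≤ EE := Nat.cast_nonneg _
          nlinarith [hW, mul_nonneg hEE0 hB0]
  obtain ⟨⟨d, σ⟩, hq, hdσ⟩ := exists_le_of_sum_le hIne hle
  rw [hI, mem_product, hDp, mem_filter, mem_range] at hq
  obtain ⟨⟨hdm, hpos⟩, -⟩ := hq
  refine ⟨σ, d, by omega, ?_⟩
  exact le_of_mul_le_mul_left (by simpa using hdσ) hpos

/-- **transport_adleman** (registered helper sub-goal of stmt-PneNP-18026 for `stub_transport`,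
part 8): some ranking `σ` and deletion count `d ≤ m` make the slice error sum of `f ∘ del σ d` at
`m` at most twice the mixture bound (`exists_good_ranking`). [folklore] -/
theorem transport_adleman :
    ∀ {α : Type*} [Fintype α] [DecidableEq α] {θ : Type*} (f : (α → Bool) → Bool) (𝒜 : Finset θ), 𝒜.Nonempty → ∀ (Kf : θ → Finset α) (κ m Δ : ℕ), (∀ A ∈ 𝒜, #(Kf A) = κ) → κ ≤ m → m ≤ Fintype.card α → 1 ≤ m → m = Fintype.card α / 2 + Δ → 0 < Δ → 2 * Δ ≤ m → 2 * Fintype.card α ≤ (Δ + 1) ^ 2 → ∃ (σ : α ≃ Fin (Fintype.card α)) (d : ℕ), d ≤ m ∧ (#((Finset.univ : Finset (α → Bool)).filter fun x => #(Finset.univ.filter fun a => x a = true) = m ∧ f (fun a => x a && decide (d ≤ #(Finset.univ.filter fun b => x b = true ∧ σ b < σ a))) = true) : ℝ) / #((Finset.univ : Finset (α → Bool)).filter fun x => #(Finset.univ.filter fun a => x a = true) = m) + (#((𝒜 ×ˢ (Finset.univ : Finset (α → Bool))).filter fun p => Kf p.1 ⊆ (Finset.univ.filter fun a => p.2 a =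 true) ∧ #(Finset.univ.filter fun a => p.2 a = true) = m ∧ f (fun a => p.2 a && decide (d ≤ #(Finset.univ.filter fun b => p.2 b = true ∧ σ b < σ a))) = false) : ℝ) / #((𝒜 ×ˢ (Finset.univ : Finset (α → Bool))).filter fun p => Kf p.1 ⊆ (Finset.univ.filter fun a => p.2 a = true) ∧ #(Finset.univ.filter fun a => p.2 a = true) = m) ≤ 2 * ((#((Finset.univ : Finset (α → Bool)).filter fun y => f y = true) : ℝ) / 2 ^ Fintype.card α + ((#((𝒜 ×ˢ (Finset.univ : Finset (α → Bool))).filter fun p => Kf p.1 ⊆ (Finset.univ.filter fun a => p.2 a = true) ∧ f p.2 = false) : ℝ) / ((#𝒜 : ℝ) * 2 ^ (Fintype.card α - κ)) + (κ : ℝ) / Real.sqrt ((Fintype.card α - κ : ℕ) + 1)) + 2 * (Δ : ℝ) * κ / m + (Fintype.card α : ℝ) / 2 / (Δ : ℝ) ^ 2) :=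
  fun f 𝒜 h𝒜 Kf _ _ _ hκ hκm hm hm1 hmΔ hΔ h2Δ hΔN =>
    exists_good_ranking f 𝒜 h𝒜 Kf hκ hκm hm hm1 hmΔ hΔ h2Δ hΔN

end Summit.PneNP.PneNP.Theorems.MonotoneSuffices.SliceTransport
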